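import Summits.AtomisticToContinuum.HydrodynamicLimit.Theorems.CollisionIsometryCLTAdaptedWeightCLTBHDVTransferMoments

/-!
# DV transfer for the line `block-h-dissipation-closure` (crux `AdaptedWeightCLT`, stmt-AtomisticToContinuum-14868),
# file 10: the quadratic log-envelope of the chaos reference; integrability of `contactDens · log chaosDens`

Support file (`--supports stmt-AtomisticToContinuum-14868`, anchor `bhDVTransfer_logChaos_anchor`) of the line lead
`prover-line-stmt-AtomisticToContinuum-14868-c4-0`, written for the registered stub `stub_dvTransfer` (S2): discharge
of the integrability side condition (i2) of the Donsker–Varadhan step `DVTransfer.dv_step` (file 5) on every good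
orbit, off the junk case `pairZ = 0`.

* `chaosDens_le` — the ceiling `chaosDens ≤ G_h(0)⁴` (`pairZ ≠ 0`);
* `pairSmear_ge` — the floor of one smeared pair term: since `‖v′‖², ‖w′‖² ≤ ‖v‖² + ‖w‖² =: R²` (energy),
  `G_h(y₃ − v′) ≥ G_h(0) e^{-(‖y₃‖² + R²)/h²}`, so the smeared pair term is bounded below by an explicit Gaussian in
  `y` times `∫ B dω`; hence `chaosDens` is bounded below by ONE flux-positive pair (`chaosDens_ge`);
* `abs_log_chaosDens_le` — the quadratic envelope `|log chaosDens(y)| ≤ L₂ + h⁻² Σ_m ‖y_m − c_m‖²`,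
  `c = (v_l, v_l′, 0, 0)`;
* `integrable_contactDens_mul_log_chaosDens` — side condition (i2).

No definitions.
-/

namespace Summit.AtomisticToContinuum.HydrodynamicLimit.Theorems.BlockHDissipation

open scoped BigOperators Topology Classical MeasureTheory ENNReal InnerProductSpace
open Filter Set MeasureTheory Real
open Literature.Analysis.FluidPDE
open Summit.AtomisticToContinuum.HydrodynamicLimit.Theorems.ContactSourceDuhamel (T3 V3 Cfg Vel Flow Flows)
open Literature.MathematicalPhysics.KineticTheory (hsDiameter collide hardSphereKernel sphereMeasure)

noncomputable section

namespace DVTransfer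

/-! ## Ceiling of the smeared pair term -/

/-- The smeared pair term is bounded by `G_h(0)⁴ ∫ B dω`. -/
theorem pairSmear_le (h : ℝ) (p : V3 × V3) (y : Quad) :
    ∫ ω, hardSphereKernel p ω * gauss4 h (p.1, p.2, (collide ω p).1, (collide ω p).2) y ∂sphereMeasure ≤
      gauss h (0 : V3) 0 ^ 4 * ∫ ω, hardSphereKernel p ω ∂sphereMeasure := by
  rw [← integral_const_mul]
  refine integral_mono (integrable_pairSmear_fibre h p y) ((integrable_hardSphereKernel_sphere p).const_mul _)
    fun ω => ?_
  have hB : 0 ≤ hardSphereKernel p ω := le_max_right _ _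
  simp only
  rw [mul_comm (gauss h (0 : V3) 0 ^ 4)]
  exact mul_le_mul_of_nonneg_left (gauss4_le_gaussMax_pow h _ y) hB

/-- **Ceiling of the chaos reference**: `chaosDens ≤ G_h(0)⁴` (nonnegative kernel family, `pairZ ≠ 0`). -/
theorem chaosDens_le {ψ : ℕ → T3 → ℝ} (hψ : ∀ N y, 0 ≤ ψ N y) (h : ℝ) {N : ℕ} (w : Cfg N) (x : T3)
    (hZ : pairZ N ψ w x ≠ 0) (y : Quad) : chaosDens N ψ h w x y ≤ gauss h (0 : V3) 0 ^ 4 := by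
  have hZpos : 0 < pairZ N ψ w x := lt_of_le_of_ne (pairZ_nonneg hψ N w x) (Ne.symm hZ)
  unfold chaosDens
  have hle : ∑ l, ∑ l', cw N ψ w x l * cw N ψ w x l' *
      ∫ ω, hardSphereKernel ((w l).2, (w l').2) ω *
        gauss4 h ((w l).2, (w l').2, (collide ω ((w l).2, (w l').2)).1, (collide ω ((w l).2, (w l').2)).2) y
        ∂sphereMeasure ≤
      ∑ l, ∑ l', cw N ψ w x l * cw N ψ w x l' *
        (gauss h (0 : V3) 0 ^ 4 * ∫ ω, hardSphereKernel ((w l).2, (w l').2) ω ∂sphereMeasure) :=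
    Finset.sum_le_sum fun l _ => Finset.sum_le_sum fun l' _ =>
      mul_le_mul_of_nonneg_left (pairSmear_le h _ y) (mul_nonneg (cw_nonneg hψ N w x l) (cw_nonneg hψ N w x l'))
  have e : ∑ l, ∑ l', cw N ψ w x l * cw N ψ w x l' *
      (gauss h (0 : V3) 0 ^ 4 * ∫ ω, hardSphereKernel ((w l).2, (w l').2) ω ∂sphereMeasure) =
      gauss h (0 : V3) 0 ^ 4 * pairZ N ψ w x := by
    unfold pairZ
    rw [Finset.mul_sum]
    refine Finset.sum_congr rfl fun l _ => ?_
    rw [Finset.mul_sum]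
    refine Finset.sum_congr rfl fun l' _ => ?_
    ring
  rw [e] at hle
  calc (pairZ N ψ w x)⁻¹ * _ ≤ (pairZ N ψ w x)⁻¹ * (gauss h (0 : V3) 0 ^ 4 * pairZ N ψ w x) :=
        mul_le_mul_of_nonneg_left hle (inv_nonneg.2 hZpos.le)
    _ = gauss h (0 : V3) 0 ^ 4 := by field_simp

/-! ## Floor of the smeared pair term -/

/-- Post-collisional speeds are bounded by the pair energy: `‖v′‖² ≤ ‖v‖² + ‖w‖²` and `‖w′‖² ≤ ‖v‖² + ‖w‖²`. -/
theorem norm_sq_collide_le (ω : Metric.sphere (0 : V3) 1) (p : V3 × V3) :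
    ‖(collide ω p).1‖ ^ 2 ≤ ‖p.1‖ ^ 2 + ‖p.2‖ ^ 2 ∧ ‖(collide ω p).2‖ ^ 2 ≤ ‖p.1‖ ^ 2 + ‖p.2‖ ^ 2 := by
  have hE := Literature.MathematicalPhysics.KineticTheory.norm_sq_collide_fst_add_norm_sq_collide_snd ω p
  constructor <;> nlinarith [sq_nonneg ‖(collide ω p).1‖, sq_nonneg ‖(collide ω p).2‖]

/-- A mollifier centred inside the ball of radius `R` is bounded below by an explicit Gaussian:
`‖a‖² ≤ R²` implies `G_h(0) e^{-(‖v‖² + R²)/h²} ≤ G_h(v − a)` (`h ≠ 0`). -/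
theorem gauss_ge_of_norm_sq_le {h : ℝ} (hh : h ≠ 0) {a : V3} {R2 : ℝ} (ha : ‖a‖ ^ 2 ≤ R2) (v : V3) :
    gauss h (0 : V3) 0 * Real.exp (-((‖v‖ ^ 2 + R2) / h ^ 2)) ≤ gauss h a v := by
  have hh2 : 0 < h ^ 2 := pow_pos (abs_pos.2 hh) 2 |>.trans_eq (sq_abs h)
  rw [gauss_eq_prefactor_mul_exp h a v, gaussMax_eq]
  refine mul_le_mul_of_nonneg_left (Real.exp_le_exp.2 ?_) (rpow_nonneg (by positivity) _)
  have htri : ‖v - a‖ ^ 2 ≤ 2 * ‖v‖ ^ 2 + 2 * ‖a‖ ^ 2 := by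
    nlinarith [norm_sub_le v a, norm_nonneg (v - a), norm_nonneg v, norm_nonneg a, sq_nonneg (‖v‖ - ‖a‖)]
  rw [neg_div, neg_le_neg_iff, div_le_div_iff₀ (by positivity) hh2]
  nlinarith

/-- **Floor of the smeared pair term**: with `R² = ‖v‖² + ‖w‖²`,
`G_h(y₁ − v) G_h(y₂ − w) (G_h(0) e^{-(‖y₃‖²+R²)/h²}) (G_h(0) e^{-(‖y₄‖²+R²)/h²}) ∫ B dω ≤ ∫ B G_h^{⊗4} dω`. -/
theorem pairSmear_ge {h : ℝ} (hh : h ≠ 0) (p : V3 × V3) (y : Quad) :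
    gauss h p.1 y.1 * gauss h p.2 y.2.1 *
        (gauss h (0 : V3) 0 * Real.exp (-((‖y.2.2.1‖ ^ 2 + (‖p.1‖ ^ 2 + ‖p.2‖ ^ 2)) / h ^ 2))) *
        (gauss h (0 : V3) 0 * Real.exp (-((‖y.2.2.2‖ ^ 2 + (‖p.1‖ ^ 2 + ‖p.2‖ ^ 2)) / h ^ 2))) *
        ∫ ω, hardSphereKernel p ω ∂sphereMeasure ≤
      ∫ ω, hardSphereKernel p ω * gauss4 h (p.1, p.2, (collide ω p).1, (collide ω p).2) y ∂sphereMeasure := by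
  rw [← integral_const_mul]
  refine integral_mono ((integrable_hardSphereKernel_sphere p).const_mul _) (integrable_pairSmear_fibre h p y)
    fun ω => ?_
  have hB : 0 ≤ hardSphereKernel p ω := le_max_right _ _
  have hc := norm_sq_collide_le ω p
  have h3 := gauss_ge_of_norm_sq_le hh hc.1 y.2.2.1
  have h4 := gauss_ge_of_norm_sq_le hh hc.2 y.2.2.2
  have n1 := gauss_nonneg h p.1 y.1
  have n2 := gauss_nonneg h p.2 y.2.1
  have m3 : 0 ≤ gauss h (0 : V3) 0 * Real.exp (-((‖y.2.2.1‖ ^ 2 + (‖p.1‖ ^ 2 + ‖p.2‖ ^ 2)) / h ^ 2)) :=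
    mul_nonneg (gauss_nonneg h 0 0) (Real.exp_nonneg _)
  have m4 : 0 ≤ gauss h (0 : V3) 0 * Real.exp (-((‖y.2.2.2‖ ^ 2 + (‖p.1‖ ^ 2 + ‖p.2‖ ^ 2)) / h ^ 2)) :=
    mul_nonneg (gauss_nonneg h 0 0) (Real.exp_nonneg _)
  simp only [gauss4]
  calc gauss h p.1 y.1 * gauss h p.2 y.2.1 *
        (gauss h (0 : V3) 0 * Real.exp (-((‖y.2.2.1‖ ^ 2 + (‖p.1‖ ^ 2 + ‖p.2‖ ^ 2)) / h ^ 2))) *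
        (gauss h (0 : V3) 0 * Real.exp (-((‖y.2.2.2‖ ^ 2 + (‖p.1‖ ^ 2 + ‖p.2‖ ^ 2)) / h ^ 2))) *
        hardSphereKernel p ω
      = hardSphereKernel p ω * (gauss h p.1 y.1 * gauss h p.2 y.2.1 *
          (gauss h (0 : V3) 0 * Real.exp (-((‖y.2.2.1‖ ^ 2 + (‖p.1‖ ^ 2 + ‖p.2‖ ^ 2)) / h ^ 2))) *
          (gauss h (0 : V3) 0 * Real.exp (-((‖y.2.2.2‖ ^ 2 + (‖p.1‖ ^ 2 + ‖p.2‖ ^ 2)) / h ^ 2)))) := by ring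
    _ ≤ hardSphereKernel p ω * (gauss h p.1 y.1 * gauss h p.2 y.2.1 * gauss h (collide ω p).1 y.2.2.1 *
          gauss h (collide ω p).2 y.2.2.2) := by
        refine mul_le_mul_of_nonneg_left ?_ hB
        exact mul_le_mul (mul_le_mul_of_nonneg_left h3 (mul_nonneg n1 n2)) h4 m4
          (mul_nonneg (mul_nonneg n1 n2) ((m3.trans h3)))

/-- **Floor of the chaos reference by one pair**: for every pair `(l, l′)`,
`pairZ⁻¹ cw_l cw_l′ × (floor of the smeared pair term of (v_l, v_l′)) ≤ chaosDens` (nonnegative kernel family,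
`h ≠ 0`, `pairZ > 0`). -/
theorem chaosDens_ge {ψ : ℕ → T3 → ℝ} (hψ : ∀ N y, 0 ≤ ψ N y) {h : ℝ} (hh : h ≠ 0) {N : ℕ} (w : Cfg N) (x : T3)
    (hZ : 0 < pairZ N ψ w x) (l l' : Fin (N + 1)) (y : Quad) :
    (pairZ N ψ w x)⁻¹ * (cw N ψ w x l * cw N ψ w x l') *
        (gauss h (w l).2 y.1 * gauss h (w l').2 y.2.1 *
          (gauss h (0 : V3) 0 * Real.exp (-((‖y.2.2.1‖ ^ 2 + (‖(w l).2‖ ^ 2 + ‖(w l').2‖ ^ 2)) / h ^ 2))) *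
          (gauss h (0 : V3) 0 * Real.exp (-((‖y.2.2.2‖ ^ 2 + (‖(w l).2‖ ^ 2 + ‖(w l').2‖ ^ 2)) / h ^ 2))) *
          ∫ ω, hardSphereKernel ((w l).2, (w l').2) ω ∂sphereMeasure) ≤
      chaosDens N ψ h w x y := by
  have hcc : 0 ≤ cw N ψ w x l * cw N ψ w x l' := mul_nonneg (cw_nonneg hψ N w x l) (cw_nonneg hψ N w x l')
  unfold chaosDens
  rw [mul_assoc]
  refine mul_le_mul_of_nonneg_left ?_ (inv_nonneg.2 hZ.le)
  refine le_trans (mul_le_mul_of_nonneg_left (pairSmear_ge hh ((w l).2, (w l').2) y) hcc) ?_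
  refine le_trans ?_ (Finset.single_le_sum (f := fun l => ∑ l', cw N ψ w x l * cw N ψ w x l' *
      ∫ ω, hardSphereKernel ((w l).2, (w l').2) ω *
        gauss4 h ((w l).2, (w l').2, (collide ω ((w l).2, (w l').2)).1, (collide ω ((w l).2, (w l').2)).2) y
        ∂sphereMeasure) (fun l _ => Finset.sum_nonneg fun l' _ =>
        mul_nonneg (mul_nonneg (cw_nonneg hψ N w x l) (cw_nonneg hψ N w x l')) (pairSmear_nonneg hh _ _))
      (Finset.mem_univ l))
  exact Finset.single_le_sum (f := fun l' => cw N ψ w x l * cw N ψ w x l' *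
      ∫ ω, hardSphereKernel ((w l).2, (w l').2) ω *
        gauss4 h ((w l).2, (w l').2, (collide ω ((w l).2, (w l').2)).1, (collide ω ((w l).2, (w l').2)).2) y
        ∂sphereMeasure)
    (fun l' _ => mul_nonneg (mul_nonneg (cw_nonneg hψ N w x l) (cw_nonneg hψ N w x l')) (pairSmear_nonneg hh _ _))
    (Finset.mem_univ l')

/-! ## The quadratic log-envelope of the chaos reference and side condition (i2) -/

/-- A flux-positive pair exists off the junk case: `pairZ > 0` gives `(l, l′)` with
`cw_l cw_l′ ∫ B((v_l, v_l′), ω) dω > 0`. -/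
theorem exists_fluxPair {ψ : ℕ → T3 → ℝ} {N : ℕ} (w : Cfg N) (x : T3) (hZ : 0 < pairZ N ψ w x) :
    ∃ l l' : Fin (N + 1), 0 < cw N ψ w x l * cw N ψ w x l' *
      ∫ ω, hardSphereKernel ((w l).2, (w l').2) ω ∂sphereMeasure := by
  by_contra hcon
  push Not at hcon
  have : pairZ N ψ w x ≤ 0 := Finset.sum_nonpos fun l _ => Finset.sum_nonpos fun l' _ => hcon l l'
  exact absurd hZ (not_lt.2 this)

/-- **The quadratic log-envelope of the chaos reference**: off the junk case there are `L` and centres `c ∈ Quad`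
with `|log chaosDens(y)| ≤ L + h⁻² Σ_m ‖y_m − c_m‖²` for all `y` (nonnegative kernel family, `h ≠ 0`). -/
theorem abs_log_chaosDens_le {ψ : ℕ → T3 → ℝ} (hψ : ∀ N y, 0 ≤ ψ N y) {h : ℝ} (hh : h ≠ 0) {N : ℕ} (w : Cfg N)
    (x : T3) (hZ : 0 < pairZ N ψ w x) :
    ∃ (L : ℝ) (c : Quad), ∀ y : Quad, |Real.log (chaosDens N ψ h w x y)| ≤
      L + (h ^ 2)⁻¹ * (‖y.1 - c.1‖ ^ 2 + ‖y.2.1 - c.2.1‖ ^ 2 + ‖y.2.2.1 - c.2.2.1‖ ^ 2 + ‖y.2.2.2 - c.2.2.2‖ ^ 2) := by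
  have hh2 : 0 < h ^ 2 := pow_pos (abs_pos.2 hh) 2 |>.trans_eq (sq_abs h)
  obtain ⟨l, l', hll⟩ := exists_fluxPair w x hZ
  set v₁ : V3 := (w l).2 with hv₁
  set v₂ : V3 := (w l').2 with hv₂
  set R2 : ℝ := ‖v₁‖ ^ 2 + ‖v₂‖ ^ 2 with hR2
  set K : ℝ := (pairZ N ψ w x)⁻¹ * (cw N ψ w x l * cw N ψ w x l') * ∫ ω, hardSphereKernel (v₁, v₂) ω ∂sphereMeasure
    with hK
  have hKpos : 0 < K := by
    rw [hK, mul_assoc]; exact mul_pos (inv_pos.2 hZ) hll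
  set P : ℝ := Real.log ((2 * π * h ^ 2) ^ (-(Module.finrank ℝ V3 : ℝ) / 2)) with hP
  have hG0 : Real.log (gauss h (0 : V3) 0) = P := by rw [gaussMax_eq]
  refine ⟨|Real.log K| + 4 * |P| + 2 * R2 / h ^ 2 + |Real.log (gauss h (0 : V3) 0 ^ 4)|, (v₁, v₂, 0, 0), fun y => ?_⟩
  -- the floor `a(y)` and the ceiling
  have hlow := chaosDens_ge hψ hh w x hZ l l' y
  have hup : chaosDens N ψ h w x y ≤ gauss h (0 : V3) 0 ^ 4 := chaosDens_le hψ h w x hZ.ne' y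
  have g1 := gauss_pos hh v₁ y.1
  have g2 := gauss_pos hh v₂ y.2.1
  have g0 : 0 < gauss h (0 : V3) 0 := gaussMax_pos hh
  have e3 := Real.exp_pos (-((‖y.2.2.1‖ ^ 2 + R2) / h ^ 2))
  have e4 := Real.exp_pos (-((‖y.2.2.2‖ ^ 2 + R2) / h ^ 2))
  have hX3 : 0 < gauss h (0 : V3) 0 * Real.exp (-((‖y.2.2.1‖ ^ 2 + R2) / h ^ 2)) := mul_pos g0 e3
  have hX4 : 0 < gauss h (0 : V3) 0 * Real.exp (-((‖y.2.2.2‖ ^ 2 + R2) / h ^ 2)) := mul_pos g0 e4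
  have hX34 := mul_pos hX3 hX4
  have hX2 := mul_pos g2 hX34
  have hX1 := mul_pos g1 hX2
  clear_value K
  set a : ℝ := (pairZ N ψ w x)⁻¹ * (cw N ψ w x l * cw N ψ w x l') *
      (gauss h v₁ y.1 * gauss h v₂ y.2.1 *
        (gauss h (0 : V3) 0 * Real.exp (-((‖y.2.2.1‖ ^ 2 + R2) / h ^ 2))) *
        (gauss h (0 : V3) 0 * Real.exp (-((‖y.2.2.2‖ ^ 2 + R2) / h ^ 2))) *
        ∫ ω, hardSphereKernel (v₁, v₂) ω ∂sphereMeasure) with ha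
  clear_value a
  have e : a = K * (gauss h v₁ y.1 * (gauss h v₂ y.2.1 *
      ((gauss h (0 : V3) 0 * Real.exp (-((‖y.2.2.1‖ ^ 2 + R2) / h ^ 2))) *
      (gauss h (0 : V3) 0 * Real.exp (-((‖y.2.2.2‖ ^ 2 + R2) / h ^ 2)))))) := by rw [ha, hK]; ring
  have hapos : 0 < a := by rw [e]; exact mul_pos hKpos hX1
  have hb := abs_log_le_of_mem hapos hlow hup
  -- `log a` explicitly
  set ι : ℝ := (h ^ 2)⁻¹ with hι
  set n1 : ℝ := ‖y.1 - v₁‖ ^ 2 with hn1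
  set n2 : ℝ := ‖y.2.1 - v₂‖ ^ 2 with hn2
  set n3 : ℝ := ‖y.2.2.1‖ ^ 2 with hn3
  set n4 : ℝ := ‖y.2.2.2‖ ^ 2 with hn4
  have hloga : Real.log a = Real.log K + 4 * P - n1 / (2 * h ^ 2) - n2 / (2 * h ^ 2) -
      (ι * n3 + R2 / h ^ 2) - (ι * n4 + R2 / h ^ 2) := by
    rw [e, Real.log_mul hKpos.ne' hX1.ne', Real.log_mul g1.ne' hX2.ne', Real.log_mul g2.ne' hX34.ne',
      Real.log_mul hX3.ne' hX4.ne', Real.log_mul g0.ne' e3.ne', Real.log_mul g0.ne' e4.ne', Real.log_exp,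
      Real.log_exp, hG0, log_gauss hh, log_gauss hh, ← hP, ← hn1, ← hn2, hι]
    field_simp
    ring
  -- assemble
  have q1 : 0 ≤ n1 := sq_nonneg _
  have q2 : 0 ≤ n2 := sq_nonneg _
  have q3 : 0 ≤ n3 := sq_nonneg _
  have q4 : 0 ≤ n4 := sq_nonneg _
  have hι0 : 0 ≤ ι := by rw [hι]; positivity
  have hR2nn : 0 ≤ R2 := by positivity
  have hRh : 0 ≤ R2 / h ^ 2 := by positivity
  have i2 : (2 * h ^ 2)⁻¹ ≤ ι := by
    rw [hι, inv_le_inv₀ (by positivity) hh2]; linarith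
  have d1 : n1 / (2 * h ^ 2) ≤ ι * n1 := by
    rw [div_eq_inv_mul]; exact mul_le_mul_of_nonneg_right i2 q1
  have d2 : n2 / (2 * h ^ 2) ≤ ι * n2 := by
    rw [div_eq_inv_mul]; exact mul_le_mul_of_nonneg_right i2 q2
  have d1' : 0 ≤ n1 / (2 * h ^ 2) := by positivity
  have d2' : 0 ≤ n2 / (2 * h ^ 2) := by positivity
  have d3' : 0 ≤ ι * n3 := mul_nonneg hι0 q3
  have d4' : 0 ≤ ι * n4 := mul_nonneg hι0 q4
  have hRR : 2 * R2 / h ^ 2 = 2 * (R2 / h ^ 2) := by ring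
  have habsa : |Real.log a| ≤ |Real.log K| + 4 * |P| + 2 * R2 / h ^ 2 + (ι * n1 + ι * n2 + ι * n3 + ι * n4) := by
    rw [hloga, hRR, abs_le]
    have hPm := neg_abs_le P
    have hPp := le_abs_self P
    have hKm := neg_abs_le (Real.log K)
    have hKp := le_abs_self (Real.log K)
    constructor <;> linarith
  have e0 : ‖y.2.2.1 - (0 : V3)‖ ^ 2 = n3 := by rw [sub_zero]
  have e0' : ‖y.2.2.2 - (0 : V3)‖ ^ 2 = n4 := by rw [sub_zero]
  simp only
  rw [e0, e0']
  have hexp : ι * (n1 + n2 + n3 + n4) = ι * n1 + ι * n2 + ι * n3 + ι * n4 := by ring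
  rw [hexp]
  linarith [abs_nonneg (Real.log (gauss h (0 : V3) 0 ^ 4))]

/-- **(i2)** For a nonnegative kernel family, `h ≠ 0`, a good initial datum and a cell-window off the junk case
(`pairZ(Φ_{kΔ} z, x) > 0`), `contactDens · log chaosDens` is integrable on `Quad`. (Stated for any window-start
configuration `w` with `pairZ(w, x) > 0`.) -/
theorem integrable_contactDens_mul_log_chaosDens {ψ : ℕ → T3 → ℝ} (hψ : ∀ N y, 0 ≤ ψ N y) {h : ℝ} (hh : h ≠ 0)
    {σ : ℝ} {N : ℕ} (Φ : Flow σ N) (γc t : ℝ) {z : Cfg N} (hz : z ∈ Φ.good) (k : ℕ) (x : T3) (w : Cfg N)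
    (hZ : 0 < pairZ N ψ w x) :
    Integrable fun y : Quad => contactDens σ N Φ ψ γc h t z k x y * Real.log (chaosDens N ψ h w x y) := by
  have hfin := finite_collisionTimes_win Φ hz γc t k
  obtain ⟨L, c, hL⟩ := abs_log_chaosDens_le hψ hh w x hZ
  have hdom := integrable_quadMoment_mul_contactDens Φ ψ γc hh t z k x hfin L (h ^ 2)⁻¹ c
  have hmeas : AEStronglyMeasurable (fun y : Quad =>
      contactDens σ N Φ ψ γc h t z k x y * Real.log (chaosDens N ψ h w x y)) volume :=
    (continuous_contactDens Φ ψ γc h t z k x hfin).aestronglyMeasurable.mul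
      (Real.measurable_log.comp_aemeasurable (integrable_chaosDens ψ hh N w x).aemeasurable).aestronglyMeasurable
  refine hdom.mono' hmeas (Eventually.of_forall fun y => ?_)
  have hp : 0 ≤ contactDens σ N Φ ψ γc h t z k x y := contactDens_nonneg hψ Φ γc hh t z k x hfin y
  rw [Real.norm_eq_abs, abs_mul, abs_of_nonneg hp, mul_comm]
  exact mul_le_mul_of_nonneg_right (hL y) hp

end DVTransfer

/-! ## Registered anchor of this support file -/

/-- ANCHOR (registered helper stub `bhDVTransfer_logChaos_anchor` of the crux item): side condition (i2) of the DV
step — for a nonnegative kernel family, `h ≠ 0`, a good initial datum and a configuration `w` with positive pair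
flux at `x`, `contactDens · log chaosDens(w, x, ·)` is integrable on `Quad`. -/
theorem bhDVTransfer_logChaos_anchor : ∀ (σ : ℝ) (N : ℕ) (ψ : ℕ → T3 → ℝ), (∀ N y, 0 ≤ ψ N y) → ∀ (h : ℝ), h ≠ 0 → ∀ (Φ : Flow σ N) (γc t : ℝ) (z : Cfg N), z ∈ Φ.good → ∀ (k : ℕ) (x : T3) (w : Cfg N), 0 < pairZ N ψ w x → MeasureTheory.Integrable (fun y : Quad => contactDens σ N Φ ψ γc h t z k x y * Real.log (chaosDens N ψ h w x y)) :=
  fun _ _ _ hψ _ hh Φ γc t _ hz k x w hZ => DVTransfer.integrable_contactDens_mul_log_chaosDens hψ hh Φ γc t hz k x w hZ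

end

end Summit.AtomisticToContinuum.HydrodynamicLimit.Theorems.BlockHDissipation
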